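import Summits.ResolutionOfSingularities.ResolutionOfSingularities.Theorems.FrobeniusLadderFRationalResolutionIsolatedAffineLogRegularChartResolution
import Summits.ResolutionOfSingularities.ResolutionOfSingularities.Theorems.FrobeniusLadderFRationalResolutionConeChartRank
import HarnessLib

/-!
# Crux `FrobeniusLadder.FRationalResolution` (stmt-ResolutionOfSingularities-15317), line `redirect`,
# stub `stub_diagonalizableQuotientResolution` — **ROUND 0 AT A SINGULAR SURFACE POINT, scheme side**: the
# affine log regular chart neighbourhood in the currency of `…IsolatedAffineLogRegularChartResolution`, with
# the cone in normal form (`…ConeChartRank`, `…ConeChartEntry`); surface case over arbitrary fields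

DATA (as served by `…IsolatedQuotientResolution.exists_sharp_affine_chart` composed with the quotient chart):
`X` integral, locally of finite type over a field, finitely many singular points; a singular `x = φ y` for an
étale `φ : Spec R → X`; a chart `ψ : P → R`, `P ⊆ ℤⁿ` finitely generated, saturated, spanning, log regular on
`D(g) ∋ y`, with unit face `0` at `y`; and `dim 𝒪_{X,x} ≤ 2`.

**`exists_roundZero_package`**: then `n = 2` and there is an affine open `V = D(h) ∋ y` of `Spec R` such that:
`y` is closed and the only non-regular point of `V`; the chart `ψ_V : P → Γ(V)` is log regular at EVERY prime of
`Γ(V)`; `𝔮 = 𝔮_y ⊆ Γ(V)` is maximal with `ψ_V(P ∖ 0) ⊆ 𝔮`; and `P = ℤF_𝔮 + {m u + l e : l ≥ 0, a l ≤ d m}` in a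
`ℤ`-basis `(u, e)` with `0 < a < d`, `I(𝔮)Γ(V)_𝔮 = 𝔪`, `dim Γ(V)_𝔮 = 2` — i.e. `(Γ(V), P, ψ_V, 𝔮)` is a cone
chart algebra point of measure `d ≥ 2` over itself (`…BaseChartAlgebra`), the input of the ring-level round
`…ConeChainCharts`. Steps (a)–(f), (h) are those of `…IsolatedAffineLogRegularChartResolution` (leafhand-4 g1).

Honest label: assembly toward ONE leaf stub (no stub, crux or summit closed). No definitions, no named facts,
no sorry. [cite: Kato1994, Def. (2.1), (10.1)] [cite: Kollar2007, §2.2] [cite: Matsumura1987, Thm. 23.7]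
-/

noncomputable section

-- single-problem summit: the doubled namespace component is forced
set_option linter.dupNamespace false

open CategoryTheory AlgebraicGeometry TopologicalSpace
open Literature.AlgebraicGeometry.Resolution
open Literature.AlgebraicGeometry.Resolution.LogBlowup Literature.AlgebraicGeometry.Resolution.LogChart
open Summit.ResolutionOfSingularities.ResolutionOfSingularities.Theorems.FRationalResolution
open Summit.ResolutionOfSingularities.ResolutionOfSingularities.Theorems.FRationalResolution.IsolatedAffineLogRegularChartResolution

namespace Summit.ResolutionOfSingularities.ResolutionOfSingularities.Theorems.FRationalResolution.ConeChartRoundZero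

/-- **Round 0 at a singular surface point.** See the module docstring. [cite: Kato1994, Def. (2.1), (10.1)]
[cite: Kollar2007, §2.2] [cite: Matsumura1987, Thm. 23.7] -/
theorem exists_roundZero_package (K : Type) [Field K] (X : Scheme.{0}) [IsIntegral X] (f : X ⟶ Spec (.of K))
    [LocallyOfFiniteType f] (hfin : (Scheme.regularLocus X)ᶜ.Finite)
    (R : CommRingCat.{0}) (φ : Spec R ⟶ X) [Etale φ] (y : Spec R) (hx : φ y ∉ Scheme.regularLocus X)
    (hdimx : ringKrullDim (X.presheaf.stalk (φ y)) ≤ (2 : ℕ))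
    {n : ℕ} (P : AddSubmonoid (Fin n → ℤ)) (hP : P.FG)
    (hsat : ∀ (v : Fin n → ℤ) (k : ℕ), 0 < k → k • v ∈ P → v ∈ P)
    (hspan : Submodule.span ℤ (P : Set (Fin n → ℤ)) = ⊤) (ψ : Multiplicative P →* R) (g : R)
    (hgy : g ∉ y.asIdeal) (hreg : ∀ (𝔭 : Ideal R) [𝔭.IsPrime], g ∉ 𝔭 → IsLogRegularAt P ψ 𝔭)
    (hfix : ∀ p : P, (p : Fin n → ℤ) ≠ 0 → ψ (Multiplicative.ofAdd p) ∈ y.asIdeal) :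
    n = 2 ∧ IsClosed ({y} : Set (Spec R)) ∧
    ∃ (V : (Spec R).Opens) (hV : IsAffineOpen V) (hyV : y ∈ V),
      (∀ z : Spec R, z ∈ V → z ≠ y → z ∈ Scheme.regularLocus (Spec R)) ∧
      (∀ (𝔓 : Ideal Γ(Spec R, V)) [𝔓.IsPrime],
        IsLogRegularAt P ((algebraMap R Γ(Spec R, V)).toMonoidHom.comp ψ) 𝔓) ∧
      (∀ (𝔓 : Ideal Γ(Spec R, V)) [𝔓.IsPrime], 𝔓 ≠ (hV.primeIdealOf ⟨y, hyV⟩).asIdeal →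
        IsRegularLocalRing (Localization.AtPrime 𝔓)) ∧
      (hV.primeIdealOf ⟨y, hyV⟩).asIdeal.IsMaximal ∧
      (∀ p : P, (p : Fin n → ℤ) ≠ 0 →
        ((algebraMap R Γ(Spec R, V)).toMonoidHom.comp ψ) (Multiplicative.ofAdd p) ∈
          (hV.primeIdealOf ⟨y, hyV⟩).asIdeal) ∧
      ¬ IsRegularLocalRing (Localization.AtPrime (hV.primeIdealOf ⟨y, hyV⟩).asIdeal) ∧
      ∃ (u e : Fin n → ℤ) (d a : ℕ), 0 < a ∧ a < d ∧
        (∀ w ∈ Submodule.span ℤ (faceMonoid P ((algebraMap R Γ(Spec R, V)).toMonoidHom.comp ψ)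
            (hV.primeIdealOf ⟨y, hyV⟩).asIdeal : Set (Fin n → ℤ)), ∀ m l : ℤ,
          w + m • u + l • e = 0 → m = 0 ∧ l = 0) ∧
        (∀ w : Fin n → ℤ, ∃ w₀ ∈ Submodule.span ℤ (faceMonoid P
            ((algebraMap R Γ(Spec R, V)).toMonoidHom.comp ψ) (hV.primeIdealOf ⟨y, hyV⟩).asIdeal :
              Set (Fin n → ℤ)), ∃ m l : ℤ, w = w₀ + m • u + l • e) ∧
        (∀ w, w ∈ P ↔ ∃ w₀ ∈ Submodule.span ℤ (faceMonoid P
            ((algebraMap R Γ(Spec R, V)).toMonoidHom.comp ψ) (hV.primeIdealOf ⟨y, hyV⟩).asIdeal :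
              Set (Fin n → ℤ)), ∃ m l : ℤ,
          0 ≤ l ∧ (a : ℤ) * l ≤ (d : ℤ) * m ∧ w = w₀ + m • u + l • e) ∧
        (ideal P ((algebraMap R Γ(Spec R, V)).toMonoidHom.comp ψ) (hV.primeIdealOf ⟨y, hyV⟩).asIdeal).map
            (algebraMap Γ(Spec R, V) (Localization.AtPrime (hV.primeIdealOf ⟨y, hyV⟩).asIdeal)) =
          IsLocalRing.maximalIdeal (Localization.AtPrime (hV.primeIdealOf ⟨y, hyV⟩).asIdeal) ∧
        ringKrullDim (Localization.AtPrime (hV.primeIdealOf ⟨y, hyV⟩).asIdeal) = (2 : ℕ) := by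
  classical
  haveI : IsLocallyNoetherian X := LocallyOfFiniteType.isLocallyNoetherian f
  haveI : IsLocallyNoetherian (Spec R) := LocallyOfFiniteType.isLocallyNoetherian φ
  haveI : JacobsonSpace (Spec R) := LocallyOfFiniteType.jacobsonSpace (φ ≫ f)
  haveI : LocallyQuasiFinite φ := locallyQuasiFinite_of_etale φ
  -- (a) `φ y` is closed; an affine open `U ∋ φ y`
  have hxcl : IsClosed ({φ y} : Set X) := IsolatedClosed.isClosed_singleton_of_finite_singularLocus K X f hfin hx
  obtain ⟨U, hU, hxU, -⟩ := exists_isAffineOpen_mem_and_subset (X := X) (x := φ y) (U := ⊤) trivial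
  -- (b) the other singular points form a finite closed set
  set T : Set X := (Scheme.regularLocus X)ᶜ \ {φ y} with hT
  have hTclosed : IsClosed T := by
    rw [← Set.biUnion_of_singleton T]
    exact (hfin.subset fun z hz => hz.1).isClosed_biUnion fun z hz =>
      IsolatedClosed.isClosed_singleton_of_finite_singularLocus K X f hfin hz.1
  -- (c) `y` is isolated in its fibre
  obtain ⟨u, huopen, hu⟩ := (isDiscrete_iff_forall_mem_exists_isOpen.mp (φ.isDiscrete_preimage_singleton (φ y)))
    y rfl
  -- (d) the open neighbourhood `W` of `y` and a basic open `D(h) ∋ y` inside it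
  set W : (Spec R).Opens :=
    ⟨u, huopen⟩ ⊓ φ ⁻¹ᵁ ⟨Tᶜ, hTclosed.isOpen_compl⟩ ⊓ φ ⁻¹ᵁ U ⊓ PrimeSpectrum.basicOpen g with hWdef
  have hyW : y ∈ W := by
    refine ⟨⟨⟨?_, ?_⟩, hxU⟩, (PrimeSpectrum.mem_basicOpen _ _).mpr hgy⟩
    · simpa [Set.mem_singleton_iff] using (show y ∈ u ∩ φ ⁻¹' {φ y} by rw [hu]; rfl)
    · show φ y ∈ Tᶜ
      exact fun h => h.2 rfl
  obtain ⟨_, ⟨h, rfl⟩, hyh, hhW⟩ := (Opens.isBasis_iff_nbhd.mp PrimeSpectrum.isBasis_basic_opens) hyW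
  -- (e) the affine open `V = D(h)` and its coordinate ring
  set V : (Spec R).Opens := PrimeSpectrum.basicOpen h with hVdef
  have hV : IsAffineOpen V := by
    rw [hVdef, ← basicOpen_eq_of_affine]
    exact (isAffineOpen_top (Spec R)).basicOpen _
  have hyV : y ∈ V := hyh
  have hVW : V ≤ W := hhW
  haveI : IsNoetherianRing Γ(Spec R, V) := IsLocallyNoetherian.component_noetherian ⟨V, hV⟩
  set 𝔮 := hV.primeIdealOf ⟨y, hyV⟩ with h𝔮def
  -- the chart on `Γ(Spec R, D(h))`
  let ψV : Multiplicative P →* Γ(Spec R, V) := (algebraMap R Γ(Spec R, V)).toMonoidHom.comp ψ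
  have hregV : ∀ (𝔓 : Ideal Γ(Spec R, V)) [𝔓.IsPrime], IsLogRegularAt P ψV 𝔓 := by
    intro 𝔓 _
    refine FixedPointResolvableNhd.isLogRegularAt_of_isLocalization (Submonoid.powers h) P ψ 𝔓 (hreg _ ?_)
    have hh𝔓 : h ∉ 𝔓.comap (algebraMap R Γ(Spec R, V)) := fun hh =>
      ‹𝔓.IsPrime›.ne_top (Ideal.eq_top_of_isUnit_mem _ (Ideal.mem_comap.mp hh)
        (IsLocalization.Away.algebraMap_isUnit h))
    have hmem : (⟨𝔓.comap (algebraMap R Γ(Spec R, V)), inferInstance⟩ : PrimeSpectrum R) ∈ V :=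
      (PrimeSpectrum.mem_basicOpen _ _).mpr hh𝔓
    exact (PrimeSpectrum.mem_basicOpen _ _).mp (hVW hmem).2
  have hfixV : ∀ p : P, (p : Fin n → ℤ) ≠ 0 → ψV (Multiplicative.ofAdd p) ∈ 𝔮.asIdeal := fun p hp =>
    (algebraMap_mem_primeIdealOf_iff hV hyV _).mpr (hfix p hp)
  -- dimension `dim Γ(V)_𝔮 = dim R_y = dim 𝒪_{X, φ y} ≤ 2`
  have hdimV : ringKrullDim (Localization.AtPrime 𝔮.asIdeal) ≤ (2 : ℕ) := by
    rw [h𝔮def, ringKrullDim_atPrime_primeIdealOf hV hyV]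
    have e₂ : (Spec.structureSheaf R).presheaf.stalk y ≃ₐ[R] Localization.AtPrime y.asIdeal :=
      IsLocalization.algEquiv y.asIdeal.primeCompl _ _
    rw [← ringKrullDim_eq_of_ringEquiv e₂.toRingEquiv]
    change ringKrullDim ((Spec R).presheaf.stalk y) ≤ _
    rw [ringKrullDim_stalk_eq_of_etale φ y]
    exact hdimx
  -- (f) every other point of `V` is a regular point
  have hV_W : ∀ {z : Spec R}, z ∈ V → z ≠ y → z ∈ Scheme.regularLocus (Spec R) := by
    intro z hzV hzy
    have hzW : z ∈ W := hVW hzV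
    have hφz : φ z ≠ φ y := fun hzz => hzy (by
      have : z ∈ u ∩ φ ⁻¹' {φ y} := ⟨hzW.1.1.1, hzz⟩
      rw [hu] at this
      exact this)
    have hφreg : φ z ∈ Scheme.regularLocus X := by
      by_contra hc
      exact (show φ z ∈ Tᶜ from hzW.1.1.2) ⟨hc, hφz⟩
    rw [Scheme.mem_regularLocus] at hφreg ⊢
    exact (isRegularLocalRing_stalk_iff_of_etale φ z).mpr hφreg
  have hisolV : ∀ (𝔓 : Ideal Γ(Spec R, V)) [𝔓.IsPrime], 𝔓 ≠ 𝔮.asIdeal →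
      IsRegularLocalRing (Localization.AtPrime 𝔓) := by
    intro 𝔓 _ hne
    set z : PrimeSpectrum Γ(Spec R, V) := ⟨𝔓, inferInstance⟩ with hzdef
    have hzV : hV.fromSpec z ∈ V := hV.range_fromSpec.le ⟨z, rfl⟩
    have hzy : hV.fromSpec z ≠ y := fun hzy => hne (by
      have h2 : hV.fromSpec z = hV.fromSpec 𝔮 := by rw [hzy, h𝔮def, hV.fromSpec_primeIdealOf ⟨y, hyV⟩]
      exact congrArg PrimeSpectrum.asIdeal (hV.fromSpec.isOpenEmbedding.injective h2))
    have hz := hV_W hzV hzy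
    rw [mem_regularLocus_fromSpec_iff hV, mem_regularLocus] at hz
    exact hz
  -- `y` is not a regular point, on the coordinate ring of `V`
  have hsingV : ¬ IsRegularLocalRing (Localization.AtPrime 𝔮.asIdeal) := by
    intro hregq
    have hyreg : y ∈ Scheme.regularLocus (Spec R) := by
      have h1 := (mem_regularLocus_fromSpec_iff hV 𝔮).mpr ((mem_regularLocus 𝔮).mpr hregq)
      rwa [h𝔮def, hV.fromSpec_primeIdealOf ⟨y, hyV⟩] at h1
    rw [Scheme.mem_regularLocus] at hyreg
    exact hx ((Scheme.mem_regularLocus _).mpr ((isRegularLocalRing_stalk_iff_of_etale φ y).mp hyreg))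
  -- (h) `y` is a closed point: `𝔮` is maximal (unramified over the maximal ideal of `φ y`), and `Spec R` is Jacobson
  have h𝔮max : 𝔮.asIdeal.IsMaximal := by
    set 𝔭 := hU.primeIdealOf ⟨φ y, hxU⟩ with h𝔭def
    haveI h𝔭max : 𝔭.asIdeal.IsMaximal := hU.primeIdealOf_isMaximal_of_isClosed ⟨φ y, hxU⟩ hxcl
    have eVU : V ≤ φ ⁻¹ᵁ U := fun z hz => (hVW hz).1.2
    have hψ' : (φ.appLE U V eVU).hom.Etale := φ.etale_appLE hU hV eVU
    letI : Algebra Γ(X, U) Γ(Spec R, V) := (φ.appLE U V eVU).hom.toAlgebra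
    haveI : Algebra.Etale Γ(X, U) Γ(Spec R, V) := hψ'
    have hcomap : 𝔮.asIdeal.comap (algebraMap Γ(X, U) Γ(Spec R, V)) = 𝔭.asIdeal :=
      congrArg PrimeSpectrum.asIdeal (hU.comap_primeIdealOf_appLE (f := φ) U V hV eVU hyV)
    exact EtaleChartPrimaryCentreAlgClosed.isMaximal_of_isMaximal_comap_of_formallyUnramified 𝔮.asIdeal
      (hcomap ▸ h𝔭max)
  have hycl : IsClosed ({y} : Set (Spec R)) := by
    have h1 : IsClosed ({𝔮} : Set (PrimeSpectrum Γ(Spec R, V))) :=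
      (PrimeSpectrum.isClosed_singleton_iff_isMaximal 𝔮).mpr h𝔮max
    have h2 : 𝔮 ∈ hV.fromSpec ⁻¹' closedPoints (Spec R) := by
      rw [hV.fromSpec.isOpenEmbedding.preimage_closedPoints]
      exact h1
    have h3 : hV.fromSpec 𝔮 ∈ closedPoints (Spec R) := h2
    rw [h𝔮def, hV.fromSpec_primeIdealOf ⟨y, hyV⟩] at h3
    exact h3
  -- the rank is `2`, and the cone is in normal form
  haveI : 𝔮.asIdeal.IsPrime := 𝔮.isPrime
  have hn : n = 2 :=
    ConeChartRank.rank_eq_two_of_not_isRegularLocalRing hP hsat hspan (hregV 𝔮.asIdeal) hfixV hdimV hsingV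
  subst hn
  obtain ⟨u₀, e₀, d, a, ha, had, hind, hspan₀, hmem, h0, hdim2⟩ :=
    ConeChartEntry.exists_normalForm_of_not_isRegularLocalRing hP hsat hspan (hregV 𝔮.asIdeal) hfixV hdimV hsingV
  exact ⟨rfl, hycl, V, hV, hyV, fun z hz hzy => hV_W hz hzy, hregV, hisolV, h𝔮max, hfixV, hsingV,
    u₀, e₀, d, a, ha, had, hind, hspan₀, hmem, h0, hdim2⟩

end Summit.ResolutionOfSingularities.ResolutionOfSingularities.Theorems.FRationalResolution.ConeChartRoundZero

end
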